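import Summits.FinalStateConjecture.FinalStateConjecture.Theorems.EIHFluxBalanceInertialRecessionVirialClassFar

/-!
# Route EIHFluxBalance — crux `InertialRecession`, abstract endgame for general `N`:
# LEMMA SPLIT, the case of a confined class versus one body

Helper file for the crux `stmt-FinalStateConjecture-10166` (virial route, `work/split/PLAN.md` "next provable case").
Mathlib-only. Under the hypotheses of `stub_pairwiseDichotomy`: let `𝒦` (`|𝒦| ≥ 2`) be a SUBLINEARLY CONFINED class, `a ∈ 𝒦`,
`c` one more body, and let every other body be linearly far from `𝒦 ∪ {c}`. Then the pair `(a, c)` is either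
linearly separated or sublinearly confined (`split_of_confined_class_vs_body`).
Proof: on a far interval `[p, q]` (`d_ac ≥ θs`, `q − p ≥ μp`): `c` is `θ/2`-isolated, so `v_c` is frozen
(`velocity_frozen_of_isolated`); the class charges `(E_𝒦, P_𝒦)` and `K_𝒦` are frozen (`cluster_charge_frozen`); the virial
inequality on the grid of `[p, q]` (`virial_inequality_on_grid`, `internalEnergy_le'`, `abs_virial_le`) bounds
`min K_𝒦` by `O(η′) + O(ε(p))`, `η′` the confinement scale, so `K_𝒦 = o(1)` on the whole interval and every member velocity
is within `o(1)` of the frozen cold velocity `V̂ = P_𝒦/√(M_𝒦² + ‖P_𝒦‖²)` (`mass_mul_norm_sub_coldVelocity_sq_le'`,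
`norm_coldVelocity_sub_le`); with slaving, `D = ξ_c − ξ_a` has a frozen derivative and `no_return_long` applies.
-/

noncomputable section

open Finset Filter Topology MeasureTheory intervalIntegral

namespace Summit.FinalStateConjecture.FinalStateConjecture.Theorems.SublinearIsFree.Virial

open Literature.Geometry.Lorentzian

variable {N : ℕ}

/-- **LEMMA SPLIT, confined class versus one body** (see the module docstring). [folklore] -/
theorem split_of_confined_class_vs_body (M : Fin N → ℝ) (ξ v : Fin N → ℝ → E3) (κ : ℝ)
    (P : ℝ → E3 → ℝ → Fin 4 → ℝ) (hM : ∀ i, 0 < M i) (hκ0 : 0 < κ) (hκ1 : κ < 1)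
    (hξ : ∀ i, ContDiff ℝ ((⊤ : ℕ∞) : WithTop ℕ∞) (ξ i))
    (hcone : ∀ i, ∀ᶠ t in atTop, ‖ξ i t‖ ≤ κ ^ 2 * t)
    (hsep : ∀ i j, i ≠ j → Tendsto (fun t ↦ ‖ξ i t - ξ j t‖) atTop atTop) (hvc : ∀ i, Continuous (v i))
    (hk : ∃ k : ℝ, 0 ≤ k ∧ k < 1 ∧ ∀ i t, ‖v i t‖ ≤ k)
    (hslave : ∀ i, Tendsto (fun t ↦ deriv (ξ i) t - v i t) atTop (𝓝 0))
    (hWL : ∀ ρ : ℝ → ℝ, Tendsto ρ atTop atTop → ∀ δ : ℝ, 0 < δ → δ < 1 → ∃ (C T : ℝ),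
      ∀ (t₁ t₂ : ℝ) (c : ℝ → E3) (R : ℝ → ℝ), T ≤ t₁ → t₁ ≤ t₂ →
      (∀ s ∈ Set.Icc t₁ t₂, ∀ s' ∈ Set.Icc t₁ t₂, ‖c s - c s'‖ ≤ 2 * |s - s'| ∧ |R s - R s'| ≤ 2 * |s - s'|) →
      (∀ s ∈ Set.Icc t₁ t₂, ρ s ≤ δ * R s ∧ ‖c s‖ + R s ≤ (κ + κ ^ 2) / 2 * s ∧
        ∀ j, ‖ξ j s - c s‖ ≤ (1 - δ) * R s ∨ (1 + δ) * R s ≤ ‖ξ j s - c s‖) →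
      ∀ μ : Fin 4, |P t₂ (c t₂) (R t₂) μ - P t₁ (c t₁) (R t₁) μ| ≤ C * ∫ s in t₁..t₂, (R s ^ (3 / 2 : ℝ))⁻¹)
    (hID : ∀ ρ : ℝ → ℝ, Tendsto ρ atTop atTop → ∀ δ : ℝ, 0 < δ → δ < 1 → ∃ (T : ℝ) (ζ : ℝ → ℝ),
      Tendsto ζ atTop (𝓝 0) ∧ ∀ (t : ℝ) (c : E3) (R : ℝ) (A : Finset (Fin N)), T ≤ t → ρ t ≤ δ * R →
      ‖c‖ + R ≤ (κ + κ ^ 2) / 2 * t → (∀ j, ‖ξ j t - c‖ ≤ (1 - δ) * R ∨ (1 + δ) * R ≤ ‖ξ j t - c‖) →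
      (∀ j, j ∈ A ↔ ‖ξ j t - c‖ ≤ (1 - δ) * R) →
      |P t c R 0 - ∑ j ∈ A, M j * (√(1 - ‖v j t‖ ^ 2))⁻¹| ≤ ζ t ∧
      ∀ k : Fin 3, |P t c R k.succ - ∑ j ∈ A, M j * (√(1 - ‖v j t‖ ^ 2))⁻¹ * v j t k| ≤ ζ t)
    (𝒦 : Finset (Fin N)) (h𝒦 : 2 ≤ 𝒦.card) {a c : Fin N} (ha : a ∈ 𝒦)
    (hconf : ∀ η : ℝ, 0 < η → ∀ᶠ t in atTop, ∀ x ∈ 𝒦, ∀ y ∈ 𝒦, ‖ξ x t - ξ y t‖ ≤ η * t)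
    {σ : ℝ} (hσ : 0 < σ)
    (hrest : ∀ᶠ t in atTop, ∀ x ∈ insert c 𝒦, ∀ z ∉ insert c 𝒦, σ * t ≤ ‖ξ z t - ξ x t‖) :
    (∃ σ' : ℝ, 0 < σ' ∧ ∀ᶠ t in atTop, σ' * t ≤ ‖ξ c t - ξ a t‖) ∨
      ∀ η : ℝ, 0 < η → ∀ᶠ t in atTop, ‖ξ c t - ξ a t‖ ≤ η * t := by
  classical
  by_cases hcf : ∀ η : ℝ, 0 < η → ∀ᶠ t in atTop, ‖ξ c t - ξ a t‖ ≤ η * t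
  · exact Or.inr hcf
  left
  push Not at hcf
  obtain ⟨s₀, hs₀, hfreq⟩ := hcf
  -- data
  obtain ⟨k, hk0, hk1, hvk⟩ := id hk
  have hv1 : ∀ x t, ‖v x t‖ < 1 := fun x t ↦ (hvk x t).trans_lt hk1
  have hdiff : ∀ x, Differentiable ℝ (ξ x) := fun x ↦ (hξ x).differentiable (by simp)
  have hne : 𝒦.Nonempty := ⟨a, ha⟩
  have hMK : 0 < ∑ i ∈ 𝒦, M i := Finset.sum_pos (fun i _ ↦ hM i) hne
  have hk2 : 0 < 1 - k ^ 2 := by nlinarith only [hk0, hk1]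
  have hΓ0 : 0 < (√(1 - k ^ 2))⁻¹ := inv_pos.mpr (Real.sqrt_pos.mpr hk2)
  -- the window law and the identification at `ρ = √t`, `δ = 1/2`
  have hρ : Tendsto (fun t : ℝ ↦ √t) atTop atTop := by
    have := tendsto_rpow_atTop (show (0 : ℝ) < 1 / 2 by norm_num)
    refine this.congr' ?_
    filter_upwards [eventually_ge_atTop 0] with t ht
    rw [Real.sqrt_eq_rpow]
  obtain ⟨C, T_W, hW⟩ := hWL (fun t ↦ √t) hρ (1 / 2) (by norm_num) (by norm_num)
  obtain ⟨T_I, ζ, hζ, hI⟩ := hID (fun t ↦ √t) hρ (1 / 2) (by norm_num) (by norm_num)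
  -- envelopes of `ζ` and of the slaving error
  obtain ⟨Fζ, hFζa, hFζ0, hFζnn, -, Tz, hTz0, hFζdom⟩ := exists_capped_envelope hζ
  have he0 : Tendsto (fun u ↦ ∑ x, ‖deriv (ξ x) u - v x u‖) atTop (𝓝 0) := by
    simpa using tendsto_finsetSum (univ : Finset (Fin N)) fun x _ ↦ (hslave x).norm
  obtain ⟨Fe, hFea, hFe0, hFenn, -, Tv, hTv0, hFedom⟩ := exists_capped_envelope he0
  -- the virial inequality package for the root `𝒦`
  obtain ⟨h, CJ, T₂, ε, hh, hCJ, hεa, hεt, hvir⟩ :=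
    virial_inequality_on_grid M ξ v κ P hM hκ0 hκ1 hξ hcone hsep hvc hk hslave hWL hID 𝒦 h𝒦
  -- the constants `θ = η = e`, `B`, `K`, `μ`
  have hκκ : 0 < κ - κ ^ 2 := by nlinarith only [hκ0, hκ1]
  obtain ⟨θ, hθdef⟩ : ∃ θ : ℝ, θ = min (min (s₀ / 16) (s₀ ^ 2 / 100)) (min (min (2 * (κ - κ ^ 2)) 1) (σ / 2)) :=
    ⟨_, rfl⟩
  have hθ0 : 0 < θ := by
    rw [hθdef]
    exact lt_min (lt_min (by positivity) (by positivity)) (lt_min (lt_min (by linarith only [hκκ]) one_pos) (by positivity))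
  have hθs : θ ≤ s₀ / 16 := hθdef ▸ (min_le_left _ _).trans (min_le_left _ _)
  have hθs2 : θ ≤ s₀ ^ 2 / 100 := hθdef ▸ (min_le_left _ _).trans (min_le_right _ _)
  have hθκ : θ ≤ 2 * (κ - κ ^ 2) := hθdef ▸ (min_le_right _ _).trans ((min_le_left _ _).trans (min_le_left _ _))
  have hθ1 : θ ≤ 1 := hθdef ▸ (min_le_right _ _).trans ((min_le_left _ _).trans (min_le_right _ _))
  have hθσ : θ ≤ σ / 2 := hθdef ▸ (min_le_right _ _).trans (min_le_right _ _)
  obtain ⟨B, hBdef⟩ : ∃ B : ℝ, B = 2 * κ ^ 2 := ⟨_, rfl⟩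
  have hB0 : 0 ≤ B := by rw [hBdef]; positivity
  obtain ⟨K, hKdef⟩ : ∃ K : ℝ, K = max 2 (B / θ) := ⟨_, rfl⟩
  have hK2 : 2 ≤ K := hKdef ▸ le_max_left _ _
  have hK0 : 0 < K := by linarith only [hK2]
  have hBK : B / K ≤ θ := by
    rw [div_le_iff₀ hK0]
    calc B = θ * (B / θ) := by field_simp
      _ ≤ θ * K := mul_le_mul_of_nonneg_left (hKdef ▸ le_max_right _ _) hθ0.le
  have hBK0 : 0 ≤ B / K := by positivity
  obtain ⟨μ, hμdef⟩ : ∃ μ : ℝ, μ = (s₀ / 2 - (θ + B / K)) / 2 := ⟨_, rfl⟩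
  have hμ : s₀ / 8 ≤ μ := by rw [hμdef]; linarith only [hBK, hθs, hs₀]
  have hμ0 : 0 < μ := by linarith only [hμ, hs₀]
  -- smallness for `no_return_long`
  have h1 : 2 * θ ≤ s₀ / 2 - (θ + B / K) - 2 * θ := by linarith only [hBK, hθs, hθ0.le]
  have h2 : 2 * θ + (θ + B / K) ≤ (s₀ / 2 - (θ + B / K) - 2 * θ) * ((s₀ / 2 - (θ + B / K)) / 2) := by
    have f1 : s₀ / 4 ≤ s₀ / 2 - (θ + B / K) - 2 * θ := by linarith only [hBK, hθs]
    have f2 : 3 * s₀ / 8 ≤ s₀ / 2 - (θ + B / K) := by linarith only [hBK, hθs]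
    have f3 : s₀ / 4 * (3 * s₀ / 8 / 2) ≤ (s₀ / 2 - (θ + B / K) - 2 * θ) * ((s₀ / 2 - (θ + B / K)) / 2) :=
      mul_le_mul f1 (by linarith only [f2]) (by positivity) (by linarith only [f1, hs₀])
    linarith only [f3, hBK, hθs2, sq_nonneg s₀, hθ0.le]
  -- the coldness budget: `K_𝒦 ≤ kbud` on far intervals gives `‖v_a − V̂‖ ≤ θ/4`
  obtain ⟨C', hC'def⟩ : ∃ C' : ℝ, C' = 2 * ((√(1 - k ^ 2))⁻¹) ^ 8 / ∑ i ∈ 𝒦, M i := ⟨_, rfl⟩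
  have hC'0 : 0 < C' := by rw [hC'def]; positivity
  obtain ⟨A', hA'def⟩ : ∃ A' : ℝ, A' = (∑ i ∈ 𝒦, M i) * (√(1 - k ^ 2))⁻¹ := ⟨_, rfl⟩
  have hA'0 : 0 ≤ A' := by rw [hA'def]; positivity
  obtain ⟨κ₂, hκ₂def⟩ : ∃ κ₂ : ℝ, κ₂ = C' * (2 * ∑ i ∈ 𝒦, M i) := ⟨_, rfl⟩
  have hκ₂0 : 0 < κ₂ := by rw [hκ₂def]; positivity
  obtain ⟨κ₁, hκ₁def⟩ : ∃ κ₁ : ℝ, κ₁ = κ₂ * (2 * A' + CJ) * (1 + 2 / μ) := ⟨_, rfl⟩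
  have hκ₁0 : 0 ≤ κ₁ := by rw [hκ₁def]; positivity
  obtain ⟨kbud, hkbdef⟩ : ∃ kb : ℝ, kb = θ ^ 2 * M a / (32 * ((√(1 - k ^ 2))⁻¹) ^ 3) := ⟨_, rfl⟩
  have hkb0 : 0 < kbud := by rw [hkbdef]; have := hM a; positivity
  obtain ⟨η', hη'def⟩ : ∃ η' : ℝ, η' = min (θ / 16) (kbud / (3 * (κ₁ + 1))) := ⟨_, rfl⟩
  have hη'0 : 0 < η' := by rw [hη'def]; exact lt_min (by positivity) (by positivity)
  have hη'θ : η' ≤ θ / 16 := hη'def ▸ min_le_left _ _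
  have hη'k : κ₁ * η' ≤ kbud / 3 := by
    have h1 : η' ≤ kbud / (3 * (κ₁ + 1)) := hη'def ▸ min_le_right _ _
    have h2 : κ₁ * η' ≤ (κ₁ + 1) * η' := mul_le_mul_of_nonneg_right (by linarith only) hη'0.le
    have h3 : (κ₁ + 1) * η' ≤ (κ₁ + 1) * (kbud / (3 * (κ₁ + 1))) := mul_le_mul_of_nonneg_left h1 (by positivity)
    have h4 : (κ₁ + 1) * (kbud / (3 * (κ₁ + 1))) = kbud / 3 := by field_simp
    linarith only [h2, h3, h4]
  -- thresholds
  have hmin : 0 < min (M c) (∑ i ∈ 𝒦, M i) := lt_min (hM c) hMK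
  have hc0 : 0 < min (1 - k) (θ / 8) := lt_min (by linarith only [hk1]) (by positivity)
  obtain ⟨T_fe, hTfe⟩ := (hFe0.eventually (eventually_le_nhds hc0)).exists_forall_of_atTop
  obtain ⟨bud, hbuddef⟩ : ∃ bud : ℝ, bud = min (θ * min (M c) (∑ i ∈ 𝒦, M i) / 72) (kbud / 24) := ⟨_, rfl⟩
  have hbud0 : 0 < bud := by rw [hbuddef]; exact lt_min (by positivity) (by positivity)
  have hbud3 : 0 < bud / 3 := by positivity
  have hlim1 : Tendsto (fun p : ℝ ↦ |C| * (2 * ((θ / 2 / 4) ^ (3 / 2 : ℝ))⁻¹ * (p ^ (1 / 2 : ℝ))⁻¹)) atTop (𝓝 0) := by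
    simpa [mul_assoc] using (Endgame.tendsto_inv_rpow_half.const_mul (2 * ((θ / 2 / 4) ^ (3 / 2 : ℝ))⁻¹)).const_mul |C|
  obtain ⟨T_b1, hTb1⟩ := (hlim1.eventually (eventually_le_nhds hbud3)).exists_forall_of_atTop
  obtain ⟨T_b2, hTb2⟩ := (hFζ0.eventually (eventually_le_nhds hbud3)).exists_forall_of_atTop
  have hεb : 0 < kbud / (3 * κ₂) := by positivity
  obtain ⟨T_ε, hTε⟩ := (hεt.eventually (eventually_le_nhds hεb)).exists_forall_of_atTop
  obtain ⟨T_cone, hTcone⟩ := (Filter.eventually_all.mpr hcone).exists_forall_of_atTop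
  obtain ⟨T_conf, hTconf⟩ := (hconf η' hη'0).exists_forall_of_atTop
  obtain ⟨T_rest, hTrest⟩ := hrest.exists_forall_of_atTop
  obtain ⟨T₀, hT₀def⟩ : ∃ T₀ : ℝ, T₀ = max (T_W) (max (T_I) (max (Tz) (max (Tv) (max (T_fe) (max (T_b1) (max (T_b2) (max (T_ε) (max (T₂) (max (T_cone) (max (T_conf) (max (T_rest) (max (1) (max (256 / θ ^ 2) (4 * h / μ)))))))))))))) := ⟨_, rfl⟩
  have h0W : T_W ≤ T₀ := hT₀def ▸ le_max_left _ _
  have h0I : T_I ≤ T₀ := hT₀def ▸ le_max_of_le_right (le_max_left _ _)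
  have h0z : Tz ≤ T₀ := hT₀def ▸ le_max_of_le_right (le_max_of_le_right (le_max_left _ _))
  have h0v : Tv ≤ T₀ := hT₀def ▸ le_max_of_le_right (le_max_of_le_right (le_max_of_le_right (le_max_left _ _)))
  have h0fe : T_fe ≤ T₀ := hT₀def ▸ le_max_of_le_right (le_max_of_le_right (le_max_of_le_right (le_max_of_le_right (le_max_left _ _))))
  have h0b1 : T_b1 ≤ T₀ := hT₀def ▸ le_max_of_le_right (le_max_of_le_right (le_max_of_le_right (le_max_of_le_right (le_max_of_le_right (le_max_left _ _)))))
  have h0b2 : T_b2 ≤ T₀ := hT₀def ▸ le_max_of_le_right (le_max_of_le_right (le_max_of_le_right (le_max_of_le_right (le_max_of_le_right (le_max_of_le_right (le_max_left _ _))))))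
  have h0ε : T_ε ≤ T₀ := hT₀def ▸ le_max_of_le_right (le_max_of_le_right (le_max_of_le_right (le_max_of_le_right (le_max_of_le_right (le_max_of_le_right (le_max_of_le_right (le_max_left _ _)))))))
  have h02 : T₂ ≤ T₀ := hT₀def ▸ le_max_of_le_right (le_max_of_le_right (le_max_of_le_right (le_max_of_le_right (le_max_of_le_right (le_max_of_le_right (le_max_of_le_right (le_max_of_le_right (le_max_left _ _))))))))
  have h0cone : T_cone ≤ T₀ := hT₀def ▸ le_max_of_le_right (le_max_of_le_right (le_max_of_le_right (le_max_of_le_right (le_max_of_le_right (le_max_of_le_right (le_max_of_le_right (le_max_of_le_right (le_max_of_le_right (le_max_left _ _)))))))))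
  have h0conf : T_conf ≤ T₀ := hT₀def ▸ le_max_of_le_right (le_max_of_le_right (le_max_of_le_right (le_max_of_le_right (le_max_of_le_right (le_max_of_le_right (le_max_of_le_right (le_max_of_le_right (le_max_of_le_right (le_max_of_le_right (le_max_left _ _))))))))))
  have h0rest : T_rest ≤ T₀ := hT₀def ▸ le_max_of_le_right (le_max_of_le_right (le_max_of_le_right (le_max_of_le_right (le_max_of_le_right (le_max_of_le_right (le_max_of_le_right (le_max_of_le_right (le_max_of_le_right (le_max_of_le_right (le_max_of_le_right (le_max_left _ _)))))))))))
  have h01 : 1 ≤ T₀ := hT₀def ▸ le_max_of_le_right (le_max_of_le_right (le_max_of_le_right (le_max_of_le_right (le_max_of_le_right (le_max_of_le_right (le_max_of_le_right (le_max_of_le_right (le_max_of_le_right (le_max_of_le_right (le_max_of_le_right (le_max_of_le_right (le_max_left _ _))))))))))))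
  have h0θ : 256 / θ ^ 2 ≤ T₀ := hT₀def ▸ le_max_of_le_right (le_max_of_le_right (le_max_of_le_right (le_max_of_le_right (le_max_of_le_right (le_max_of_le_right (le_max_of_le_right (le_max_of_le_right (le_max_of_le_right (le_max_of_le_right (le_max_of_le_right (le_max_of_le_right (le_max_of_le_right (le_max_left _ _)))))))))))))
  have h0h : 4 * h / μ ≤ T₀ := hT₀def ▸ le_max_of_le_right (le_max_of_le_right (le_max_of_le_right (le_max_of_le_right (le_max_of_le_right (le_max_of_le_right (le_max_of_le_right (le_max_of_le_right (le_max_of_le_right (le_max_of_le_right (le_max_of_le_right (le_max_of_le_right (le_max_of_le_right (le_max_right _ _)))))))))))))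
  have hT₀pos : 0 < T₀ := one_pos.trans_le h01
  -- pointwise facts after `T₀`
  have hslave1 : ∀ x s, T₀ ≤ s → ‖deriv (ξ x) s - v x s‖ ≤ min (1 - k) (θ / 8) := by
    intro x s hs
    have h1 : ‖deriv (ξ x) s - v x s‖ ≤ ∑ y, ‖deriv (ξ y) s - v y s‖ :=
      Finset.single_le_sum (f := fun y ↦ ‖deriv (ξ y) s - v y s‖) (fun _ _ ↦ norm_nonneg _) (mem_univ x)
    exact (h1.trans (hFedom T₀ h0v s T₀ hs (by linarith only [hs, hT₀pos]))).trans (hTfe T₀ h0fe)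
  have hspeed1 : ∀ x s, T₀ ≤ s → ‖deriv (ξ x) s‖ ≤ 1 := by
    intro x s hs
    have h1 := hslave1 x s hs
    have h2 := min_le_left (1 - k) (θ / 8)
    calc ‖deriv (ξ x) s‖ = ‖(deriv (ξ x) s - v x s) + v x s‖ := by rw [sub_add_cancel]
      _ ≤ ‖deriv (ξ x) s - v x s‖ + ‖v x s‖ := norm_add_le _ _
      _ ≤ 1 := by linarith only [h1, h2, hvk x s]
  have hspeed2 : ∀ x s, T₀ ≤ s → ‖deriv (ξ x) s‖ ≤ 2 := fun x s hs ↦ (hspeed1 x s hs).trans (by norm_num)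
  have hconeT : ∀ s, T₀ ≤ s → ∀ x, ‖ξ x s‖ ≤ κ ^ 2 * s := fun s hs x ↦ hTcone s (h0cone.trans hs) x
  have hconfT : ∀ s, T₀ ≤ s → ∀ x ∈ 𝒦, ∀ y ∈ 𝒦, ‖ξ x s - ξ y s‖ ≤ η' * s := fun s hs ↦ hTconf s (h0conf.trans hs)
  have hrestT : ∀ s, T₀ ≤ s → ∀ x ∈ insert c 𝒦, ∀ z ∉ insert c 𝒦, σ * s ≤ ‖ξ z s - ξ x s‖ := fun s hs ↦
    hTrest s (h0rest.trans hs)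
  have hsqrt : ∀ s, T₀ ≤ s → √s ≤ θ / 2 * s / 8 := by
    intro s hs
    have hs0 : 0 ≤ s := by linarith only [hs, hT₀pos]
    have hθ2 : 0 < θ ^ 2 := by positivity
    have h64 : 256 ≤ θ ^ 2 * s := by
      have h64' := (div_le_iff₀ hθ2).mp (h0θ.trans hs)
      linarith only [h64']
    have hy : 0 ≤ θ / 2 * s / 8 := by positivity
    have hle : s ≤ (θ / 2 * s / 8) ^ 2 := by nlinarith only [h64, hs0]
    calc √s ≤ √((θ / 2 * s / 8) ^ 2) := Real.sqrt_le_sqrt hle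
      _ = θ / 2 * s / 8 := Real.sqrt_sq hy
  have hcapT : ∀ x s, T₀ ≤ s → ‖ξ x s‖ + θ / 2 / 4 * s ≤ (κ + κ ^ 2) / 2 * s := by
    intro x s hs
    have hc' := hconeT s hs x
    have hs0 : 0 ≤ s := by linarith only [hs, hT₀pos]
    have hq : θ / 2 / 4 * s ≤ (κ - κ ^ 2) / 2 * s := mul_le_mul_of_nonneg_right (by linarith only [hθκ, hθ0]) hs0
    linarith only [hc', hq]
  -- the budget `Bd(p)` and its smallness
  have hBdle : ∀ p s, T₀ ≤ p → p ≤ s →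
      |C| * (2 * ((θ / 2 / 4) ^ (3 / 2 : ℝ))⁻¹ * (p ^ (1 / 2 : ℝ))⁻¹) + ζ p + ζ s ≤
        min (θ * min (M c) (∑ i ∈ 𝒦, M i) / 72) (kbud / 24) := by
    intro p s hp hps
    have hp0 : 0 < p := hT₀pos.trans_le hp
    have hb1 := hTb1 p (h0b1.trans hp)
    have hb2 := hTb2 p (h0b2.trans hp)
    have hz1 : ζ p ≤ Fζ p := hFζdom T₀ h0z p p hp (by linarith only [hp0])
    have hz2 : ζ s ≤ Fζ p := hFζdom T₀ h0z s p (hp.trans hps) (by linarith only [hp0, hps])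
    rw [← hbuddef]
    linarith only [hb1, hb2, hz1, hz2]
  -- the relative position
  obtain ⟨D, hDdef⟩ : ∃ D : ℝ → E3, D = fun t ↦ ξ c t - ξ a t := ⟨_, rfl⟩
  have hD : Differentiable ℝ D := by rw [hDdef]; exact (hdiff c).sub (hdiff a)
  have hDap : ∀ t, D t = ξ c t - ξ a t := fun t ↦ by rw [hDdef]
  have hDder : ∀ t, deriv D t = deriv (ξ c) t - deriv (ξ a) t := fun t ↦ by
    rw [hDdef]; exact deriv_sub (hdiff c t) (hdiff a t)
  have hspeedD : ∀ s, T₀ ≤ s → ‖deriv D s‖ ≤ 2 := fun s hs ↦ by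
    rw [hDder]
    exact (norm_sub_le _ _).trans (by linarith only [hspeed1 c s hs, hspeed1 a s hs])
  have hboundD : ∀ s, T₀ ≤ s → ‖D s‖ ≤ B * s := fun s hs ↦ by
    rw [hDap, hBdef]
    exact (norm_sub_le _ _).trans (by linarith only [hconeT s hs c, hconeT s hs a])
  -- THE FAR-INTERVAL ANALYSIS
  have hfrozen := far_interval_frozen M ξ v κ P hM hvc hk0 hk1 hvk hv1 hk2 hdiff 𝒦 ha hne hMK (fun t ↦ √t) C T_W T_I ζ
    hW hI hh hCJ hεa hvir hσ hθ0 hθ1 hθσ hμdef hμ0 hη'0 hη'θ hkbdef hC'def hC'0 hA'def hA'0 hκ₂def hκ₂0 hκ₁def hη'k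
    hT₀pos h0W h0I h02 h0h hslave1 hspeed2 hconfT hrestT hsqrt hcapT hBdle (fun p hp ↦ hTε p (h0ε.trans hp)) hDap hDder
  -- a late time at which the pair is seen at scale `s₀ t`, and `no_return_long`
  obtain ⟨t₀, ht₀, hbig⟩ := hfreq.forall_exists_of_atTop (K * T₀)
  have ht₀0 : 0 < t₀ := lt_of_lt_of_le (by positivity) ht₀
  have hhalf : s₀ * t₀ / 2 ≤ s₀ * t₀ := half_le_self (mul_pos hs₀ ht₀0).le
  have hb : s₀ * t₀ < ‖ξ c t₀ - ξ a t₀‖ := hbig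
  have hbig' : s₀ * t₀ / 2 ≤ ‖D t₀‖ := (hhalf.trans hb.le).trans_eq (congrArg norm (hDap t₀)).symm
  have hnr := no_return_long hD hT₀pos hK2 hθ0 hθ0.le hB0 hspeedD hboundD hfrozen h1 h2 ht₀ hbig'
  refine ⟨θ, hθ0, ?_⟩
  filter_upwards [eventually_ge_atTop t₀] with t ht
  exact (hnr t ht).trans_eq (congrArg norm (hDap t))

/-- Registered one-line form of `split_of_confined_class_vs_body`. [folklore] -/
theorem split_of_confined_class_vs_body' : open Literature.Geometry.Lorentzian Filter Topology Finset MeasureTheory intervalIntegral in ∀ {N : ℕ} (M : Fin N → ℝ) (ξ v : Fin N → ℝ → E3) (κ : ℝ) (P : ℝ → E3 → ℝ → Fin 4 → ℝ) (hM : ∀ i, 0 < M i) (hκ0 : 0 < κ) (hκ1 : κ < 1) (hξ : ∀ i, ContDiff ℝ ((⊤ : ℕ∞) : WithTop ℕ∞) (ξ i)) (hcone : ∀ i, ∀ᶠ t in atTop, ‖ξ i t‖ ≤ κ ^ 2 * t) (hsep : ∀ i j, i ≠ j → Tendsto (fun t ↦ ‖ξ i t - ξ j t‖) atTop atTop) (hvc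 : ∀ i, Continuous (v i)) (hk : ∃ k : ℝ, 0 ≤ k ∧ k < 1 ∧ ∀ i t, ‖v i t‖ ≤ k) (hslave : ∀ i, Tendsto (fun t ↦ deriv (ξ i) t - v i t) atTop (𝓝 0)) (hWL : ∀ ρ : ℝ → ℝ, Tendsto ρ atTop atTop → ∀ δ : ℝ, 0 < δ → δ < 1 → ∃ (C T : ℝ), ∀ (t₁ t₂ : ℝ) (c : ℝ → E3) (R : ℝ → ℝ), T ≤ t₁ → t₁ ≤ t₂ → (∀ s ∈ Set.Icc t₁ t₂, ∀ s' ∈ Set.Icc t₁ t₂, ‖c s - c s'‖ ≤ 2 * |s - s'| ∧ |R s - R s'| ≤ 2 * |s - s'|) → (∀ s ∈ Set.Icc t₁ t₂, ρ s ≤ δ * R s ∧ ‖c s‖ + R s ≤ (κ + κ ^ 2) / 2 * s ∧ ∀ j, ‖ξ j s - c s‖ ≤ (1 - δ) * R s ∨ (1 + δ) * R s ≤ ‖ξ j s - c s‖) → ∀ μ : Fin 4, |P t₂ (c t₂) (R t₂) μ - P t₁ (c t₁) (R t₁) μ| ≤ C * ∫ s in t₁..t₂, (R s ^ (3 / 2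 : ℝ))⁻¹) (hID : ∀ ρ : ℝ → ℝ, Tendsto ρ atTop atTop → ∀ δ : ℝ, 0 < δ → δ < 1 → ∃ (T : ℝ) (ζ : ℝ → ℝ), Tendsto ζ atTop (𝓝 0) ∧ ∀ (t : ℝ) (c : E3) (R : ℝ) (A : Finset (Fin N)), T ≤ t → ρ t ≤ δ * R → ‖c‖ + R ≤ (κ + κ ^ 2) / 2 * t → (∀ j, ‖ξ j t - c‖ ≤ (1 - δ) * R ∨ (1 + δ) * R ≤ ‖ξ j t - c‖) → (∀ j, j ∈ A ↔ ‖ξ j t - c‖ ≤ (1 - δ) * R) → |P t c R 0 - ∑ j ∈ A, M j * (√(1 - ‖v j t‖ ^ 2))⁻¹| ≤ ζ t ∧ ∀ k : Fin 3, |P t c R k.succ - ∑ j ∈ A, M j * (√(1 - ‖v j t‖ ^ 2))⁻¹ * v j t k| ≤ ζ t) (𝒦 : Finset (Fin N)) (h𝒦 : 2 ≤ 𝒦.card) {a c : Fin N} (ha : a ∈ 𝒦) (hconf : ∀ η : ℝ, 0 < η → ∀ᶠ t in atTop, ∀ x ∈ 𝒦, ∀ y ∈ 𝒦, ‖ξ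 x t - ξ y t‖ ≤ η * t) {σ : ℝ} (hσ : 0 < σ) (hrest : ∀ᶠ t in atTop, ∀ x ∈ insert c 𝒦, ∀ z ∉ insert c 𝒦, σ * t ≤ ‖ξ z t - ξ x t‖),  (∃ σ' : ℝ, 0 < σ' ∧ ∀ᶠ t in atTop, σ' * t ≤ ‖ξ c t - ξ a t‖) ∨ ∀ η : ℝ, 0 < η → ∀ᶠ t in atTop, ‖ξ c t - ξ a t‖ ≤ η * t :=
  fun M ξ v κ P hM hκ0 hκ1 hξ hcone hsep hvc hk hslave hWL hID 𝒦 h𝒦 _ _ ha hconf _ hσ hrest ↦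
    split_of_confined_class_vs_body M ξ v κ P hM hκ0 hκ1 hξ hcone hsep hvc hk hslave hWL hID 𝒦 h𝒦 ha hconf hσ hrest

end Summit.FinalStateConjecture.FinalStateConjecture.Theorems.SublinearIsFree.Virial

end
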